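import Mathlib
import Literature.Analysis.Matrix.KyFanMaximumPrinciple
import Literature.Analysis.Matrix.EigenvalueCountOnSubspaces
import Literature.Algebra.Polynomial.MiddleMatrixSignature

/-!
# Tower graft line — SIGNED CROSSINGS I: eigen-frames as trial subspaces, and the inertia bookkeeping

Structure file for LINE (B) `Cruxes/WeakLifting/Lines/tower_graft.lean` (crux `WeakLifting` = stmt-ValiantsHypothesis-19561),
first of the SIGNED-CROSSING series (sequel of `…TowerGraftZoneFlux` / `…SteepZone` / `…CoEulerZone` / `…EulerShiftZone`).
Those zone laws need a LOEWNER-MONOTONE zone (positive definite increments on a whole interval); the signed-crossing law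
(`…SignedCrossingLaw`) needs monotonicity only AT THE KERNEL VECTORS OF THE ROOTS.  This file: the static trial-subspace
ingredients, for a real symmetric `A : Matrix ι ι ℝ` with Mathlib's spectrum `hA.eigenvalues : ι → ℝ`, `hA.eigenvectorBasis`.

§1 `abs_dotProduct_mulVec_le` — `|xᵀMx| ≤ (Σ_{i,j} |M i j|)·(x ⬝ x)` (the entrywise `ℓ¹` size controls a quadratic form).
§2 THE EIGEN-FRAME of a predicate `p` on the spectrum, `V = [u_i]_{p(λ_i)}` (columns = the eigenvectors with `p(λ_i)`), written
   inline as `Matrix.of fun x j => (hA.eigenvectorBasis j.1).ofLp x` over the subtype `{i // p (λ_i)}`: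
   `frame_mulVec` (`Vc = Σ c_j u_j`), `dotProduct_frame_mulVec` (eigen-coordinates), `frame_mulVec_dotProduct_self`
   (`Vc ⬝ Vc = c ⬝ c`), `mulVec_frame_mulVec` (`A(Vc) = Σ c_jλ_j u_j`), `frame_mulVec_dotProduct_mulVec`
   (`(Vc)ᵀA(Vc) = Σ λ_j c_j²`), `frame_mulVec_ne_zero`, `card_frame` (`|{i // p λ_i}| = #{i | p λ_i}`).
§3 inertia bookkeeping: `card_filter_eigenvalues₀_eq_card_filter_eigenvalues` (sorted `eigenvalues₀` vs unsorted `eigenvalues`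
   counts — the bridge to the `ν₋` of `…ZoneFlux`; `ν₋ + ν₀ + ν₊ = |ι|` is the tree's
   `Literature.Algebra.Polynomial.MiddleMatrixSignature.card_eigenvalues_neg_add_zero_add_pos`), `card_nonpos_eq`, `card_nonneg_eq`, `zeroCount_eq_zero_iff_det_ne_zero`, `negCount_neg_eq_posCount` (counting through `A ↦ −A`).
Def-free; Mathlib + `Literature.Analysis.Matrix.{KyFanMaximumPrinciple, EigenvalueCountOnSubspaces}`, `Literature.Algebra.Polynomial.MiddleMatrixSignature`.
Seat: prover val-sym-lift-p2 g24, `--supports stmt-ValiantsHypothesis-19561 --as helper`.  Zero stub credit; S4/S5, TowerB, WeakLifting,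
Conjecture B, 18050, VP ≠ VNP untouched.  [folklore: spectral theorem bookkeeping, Horn–Johnson §4.1–4.2; packaging this work]
-/

-- `Summit.ValiantsHypothesis.ValiantsHypothesis.…` repeats a component by the D-0017 layout
-- (single-conjunct summit), which the `dupNamespace` linter flags; the name is mandated.
set_option linter.dupNamespace false
set_option autoImplicit false

namespace Summit.ValiantsHypothesis.ValiantsHypothesis.Theorems.KPlusLogSqLaw.TowerGraft

open Matrix Finset
open scoped BigOperators Topology
open Literature.Analysis.Matrix (KyFan.eigenvectorBasis_dotProduct)

namespace SignedCrossing

variable {ι : Type} [Fintype ι] [DecidableEq ι]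

/-! ## §1 The entrywise `ℓ¹` size controls a quadratic form -/

omit [DecidableEq ι] in
/-- `|xᵀMx| ≤ (Σ_{i,j} |M i j|)·(x ⬝ x)`. [folklore] -/
theorem abs_dotProduct_mulVec_le (M : Matrix ι ι ℝ) (x : ι → ℝ) :
    |x ⬝ᵥ M *ᵥ x| ≤ (∑ i, ∑ j, |M i j|) * (x ⬝ᵥ x) := by
  have hx0 : 0 ≤ x ⬝ᵥ x := by
    unfold dotProduct
    exact Finset.sum_nonneg fun i _ => mul_self_nonneg (x i)
  have hsq : ∀ i, x i * x i ≤ x ⬝ᵥ x := fun i => by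
    unfold dotProduct
    exact Finset.single_le_sum (fun j _ => mul_self_nonneg (x j)) (Finset.mem_univ i)
  have hprod : ∀ i j, |x i * x j| ≤ x ⬝ᵥ x := by
    intro i j
    rw [abs_mul]
    nlinarith [hsq i, hsq j, abs_nonneg (x i), abs_nonneg (x j), abs_mul_abs_self (x i), abs_mul_abs_self (x j),
      sq_nonneg (|x i| - |x j|)]
  have hexp : x ⬝ᵥ M *ᵥ x = ∑ i, ∑ j, M i j * (x i * x j) := by
    unfold dotProduct Matrix.mulVec dotProduct
    refine Finset.sum_congr rfl fun i _ => ?_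
    rw [Finset.mul_sum]
    exact Finset.sum_congr rfl fun j _ => by ring
  rw [hexp, Finset.sum_mul]
  refine (Finset.abs_sum_le_sum_abs _ _).trans (Finset.sum_le_sum fun i _ => ?_)
  rw [Finset.sum_mul]
  refine (Finset.abs_sum_le_sum_abs _ _).trans (Finset.sum_le_sum fun j _ => ?_)
  rw [abs_mul]
  exact mul_le_mul_of_nonneg_left (hprod i j) (abs_nonneg _)

omit [DecidableEq ι] in
/-- entrywise size of a difference is symmetric. [folklore] -/
theorem sum_abs_sub_comm (M N : Matrix ι ι ℝ) : (∑ i, ∑ j, |(M - N) i j|) = ∑ i, ∑ j, |(N - M) i j| := by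
  refine Finset.sum_congr rfl fun i _ => Finset.sum_congr rfl fun j _ => ?_
  rw [Matrix.sub_apply, Matrix.sub_apply, abs_sub_comm]

/-! ## §2 The eigen-frame of a predicate on the spectrum -/

section Frame

/-- the frame `V c = Σ_j c_j u_j` over the eigenvectors `u_j` with `p(λ_j)`. [folklore] -/
theorem frame_mulVec {A : Matrix ι ι ℝ} (hA : A.IsHermitian) (p : ℝ → Prop) [DecidablePred p]
    (c : {i // p (hA.eigenvalues i)} → ℝ) :
    (Matrix.of fun x (j : {i // p (hA.eigenvalues i)}) => (hA.eigenvectorBasis j.1).ofLp x) *ᵥ c =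
      ∑ j, c j • (hA.eigenvectorBasis j.1).ofLp := by
  funext x
  simp only [Matrix.mulVec, dotProduct, Matrix.of_apply, Finset.sum_apply, Pi.smul_apply, smul_eq_mul]
  exact Finset.sum_congr rfl fun j _ => mul_comm _ _

/-- eigen-coordinates of a frame vector: `u_i ⬝ V c = c_i` on the frame, `0` off it. [folklore] -/
theorem dotProduct_frame_mulVec {A : Matrix ι ι ℝ} (hA : A.IsHermitian) (p : ℝ → Prop) [DecidablePred p]
    (c : {i // p (hA.eigenvalues i)} → ℝ) (i : ι) :
    (hA.eigenvectorBasis i).ofLp ⬝ᵥ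
        ((Matrix.of fun x (j : {i // p (hA.eigenvalues i)}) => (hA.eigenvectorBasis j.1).ofLp x) *ᵥ c) =
      if h : p (hA.eigenvalues i) then c ⟨i, h⟩ else 0 := by
  rw [frame_mulVec, dotProduct_sum]
  simp_rw [dotProduct_smul, smul_eq_mul, KyFan.eigenvectorBasis_dotProduct hA]
  by_cases h : p (hA.eigenvalues i)
  · rw [dif_pos h, Finset.sum_eq_single ⟨i, h⟩]
    · simp
    · intro j _ hj
      have : i ≠ j.1 := fun heq => hj (Subtype.ext heq.symm)
      simp [this]
    · intro hni
      exact absurd (Finset.mem_univ _) hni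
  · rw [dif_neg h]
    refine Finset.sum_eq_zero fun j _ => ?_
    have : i ≠ j.1 := fun heq => h (heq ▸ j.2)
    simp [this]

/-- a frame vector has the dot-square of its coordinates: `V c ⬝ V c = c ⬝ c`. [folklore] -/
theorem frame_mulVec_dotProduct_self {A : Matrix ι ι ℝ} (hA : A.IsHermitian) (p : ℝ → Prop) [DecidablePred p]
    (c : {i // p (hA.eigenvalues i)} → ℝ) :
    ((Matrix.of fun x (j : {i // p (hA.eigenvalues i)}) => (hA.eigenvectorBasis j.1).ofLp x) *ᵥ c) ⬝ᵥ
        ((Matrix.of fun x (j : {i // p (hA.eigenvalues i)}) => (hA.eigenvectorBasis j.1).ofLp x) *ᵥ c) =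
      c ⬝ᵥ c := by
  rw [frame_mulVec, sum_dotProduct]
  simp_rw [dotProduct_sum, smul_dotProduct, dotProduct_smul, smul_eq_mul, KyFan.eigenvectorBasis_dotProduct hA]
  unfold dotProduct
  refine Finset.sum_congr rfl fun j _ => ?_
  rw [Finset.sum_eq_single j]
  · simp
  · intro k _ hk
    have : (j.1 : ι) ≠ k.1 := fun heq => hk (Subtype.ext heq).symm
    simp [this]
  · intro hnj
    exact absurd (Finset.mem_univ _) hnj

/-- the matrix acts diagonally on a frame vector: `A (V c) = Σ_j (c_j λ_j) u_j`. [folklore] -/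
theorem mulVec_frame_mulVec {A : Matrix ι ι ℝ} (hA : A.IsHermitian) (p : ℝ → Prop) [DecidablePred p]
    (c : {i // p (hA.eigenvalues i)} → ℝ) :
    A *ᵥ ((Matrix.of fun x (j : {i // p (hA.eigenvalues i)}) => (hA.eigenvectorBasis j.1).ofLp x) *ᵥ c) =
      ∑ j, (c j * hA.eigenvalues j.1) • (hA.eigenvectorBasis j.1).ofLp := by
  rw [frame_mulVec, Matrix.mulVec_sum]
  refine Finset.sum_congr rfl fun j _ => ?_
  rw [Matrix.mulVec_smul, mul_smul]
  congr 1
  exact hA.mulVec_eigenvectorBasis j.1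

/-- the quadratic form on a frame vector: `(V c)ᵀ A (V c) = Σ_j λ_j c_j²`. [folklore] -/
theorem frame_mulVec_dotProduct_mulVec {A : Matrix ι ι ℝ} (hA : A.IsHermitian) (p : ℝ → Prop) [DecidablePred p]
    (c : {i // p (hA.eigenvalues i)} → ℝ) :
    ((Matrix.of fun x (j : {i // p (hA.eigenvalues i)}) => (hA.eigenvectorBasis j.1).ofLp x) *ᵥ c) ⬝ᵥ
        A *ᵥ ((Matrix.of fun x (j : {i // p (hA.eigenvalues i)}) => (hA.eigenvectorBasis j.1).ofLp x) *ᵥ c) =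
      ∑ j, hA.eigenvalues j.1 * c j ^ 2 := by
  rw [mulVec_frame_mulVec, dotProduct_sum]
  refine Finset.sum_congr rfl fun j _ => ?_
  rw [dotProduct_smul, smul_eq_mul, dotProduct_comm, dotProduct_frame_mulVec, dif_pos j.2]
  ring

/-- a nonzero coordinate vector gives a nonzero frame vector. [folklore] -/
theorem frame_mulVec_ne_zero {A : Matrix ι ι ℝ} (hA : A.IsHermitian) (p : ℝ → Prop) [DecidablePred p]
    {c : {i // p (hA.eigenvalues i)} → ℝ} (hc : c ≠ 0) :
    (Matrix.of fun x (j : {i // p (hA.eigenvalues i)}) => (hA.eigenvectorBasis j.1).ofLp x) *ᵥ c ≠ 0 := by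
  intro h0
  apply hc
  funext j
  have h := dotProduct_frame_mulVec hA p c j.1
  rw [h0, dotProduct_zero, dif_pos j.2] at h
  simpa using h.symm

/-- the frame has `#{i | p(λ_i)}` columns. [folklore] -/
theorem card_frame {A : Matrix ι ι ℝ} (hA : A.IsHermitian) (p : ℝ → Prop) [DecidablePred p] :
    Fintype.card {i // p (hA.eigenvalues i)} = (univ.filter fun i => p (hA.eigenvalues i)).card :=
  Fintype.card_subtype _

end Frame

/-! ## §3 Inertia bookkeeping -/

omit [DecidableEq ι] in
/-- sorted and unsorted enumerations count the same: `#{k | p(λ↓ₖ)} = #{i | p(λ_i)}`. [folklore] -/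
theorem card_filter_eigenvalues₀_eq_card_filter_eigenvalues {A : Matrix ι ι ℝ} [DecidableEq ι] (hA : A.IsHermitian)
    (p : ℝ → Prop) [DecidablePred p] :
    (univ.filter fun k => p (hA.eigenvalues₀ k)).card = (univ.filter fun i => p (hA.eigenvalues i)).card := by
  rw [← Fintype.card_subtype, ← Fintype.card_subtype]
  exact (Fintype.card_congr (Equiv.subtypeEquiv (Fintype.equivOfCardEq (Fintype.card_fin _)).symm fun i => Iff.rfl)).symm

/-- `#{λ_i ≤ 0} = ν₋ + ν₀`. [folklore] -/
theorem card_nonpos_eq {A : Matrix ι ι ℝ} (hA : A.IsHermitian) :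
    (univ.filter fun i => hA.eigenvalues i ≤ 0).card =
      (univ.filter fun i => hA.eigenvalues i < 0).card + (univ.filter fun i => hA.eigenvalues i = 0).card := by
  classical
  rw [← Finset.card_union_of_disjoint]
  · congr 1
    ext i
    simp only [Finset.mem_filter, Finset.mem_univ, true_and, Finset.mem_union]
    exact le_iff_lt_or_eq
  · rw [Finset.disjoint_filter]
    intro i _ h1 h2
    rw [h2] at h1
    exact lt_irrefl _ h1

/-- `#{0 ≤ λ_i} = ν₊ + ν₀`. [folklore] -/
theorem card_nonneg_eq {A : Matrix ι ι ℝ} (hA : A.IsHermitian) :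
    (univ.filter fun i => 0 ≤ hA.eigenvalues i).card =
      (univ.filter fun i => 0 < hA.eigenvalues i).card + (univ.filter fun i => hA.eigenvalues i = 0).card := by
  classical
  rw [← Finset.card_union_of_disjoint]
  · congr 1
    ext i
    simp only [Finset.mem_filter, Finset.mem_univ, true_and, Finset.mem_union]
    constructor
    · intro h
      rcases h.lt_or_eq with h | h
      · exact Or.inl h
      · exact Or.inr h.symm
    · rintro (h | h)
      · exact h.le
      · exact h.symm.le
  · rw [Finset.disjoint_filter]
    intro i _ h1 h2
    rw [h2] at h1
    exact lt_irrefl _ h1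

/-- `ν₀ = 0 ↔ det ≠ 0`. [folklore] -/
theorem zeroCount_eq_zero_iff_det_ne_zero {A : Matrix ι ι ℝ} (hA : A.IsHermitian) :
    (univ.filter fun i => hA.eigenvalues i = 0).card = 0 ↔ A.det ≠ 0 := by
  classical
  rw [Finset.card_eq_zero, Finset.filter_eq_empty_iff, hA.det_eq_prod_eigenvalues, Finset.prod_ne_zero_iff]
  simp

/-- counting through `A ↦ −A`: `#{λ_i(−A) < 0} = #{0 < λ_i(A)}` and `#{λ_i(−A) ≤ 0} = #{0 ≤ λ_i(A)}`. [folklore] -/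
theorem negCount_neg_eq_posCount {A : Matrix ι ι ℝ} (hA : A.IsHermitian) (hA' : (-A).IsHermitian) :
    (univ.filter fun i => hA'.eigenvalues i < 0).card = (univ.filter fun i => 0 < hA.eigenvalues i).card ∧
    (univ.filter fun i => hA'.eigenvalues i ≤ 0).card = (univ.filter fun i => 0 ≤ hA.eigenvalues i).card := by
  classical
  constructor
  · rw [Literature.Analysis.Matrix.EigenvalueCountOnSubspaces.card_filter_eigenvalues_neg hA hA' (fun x => x < 0)]
    congr 1
    ext i
    simp
  · rw [Literature.Analysis.Matrix.EigenvalueCountOnSubspaces.card_filter_eigenvalues_neg hA hA' (fun x => x ≤ 0)]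
    congr 1
    ext i
    simp

end SignedCrossing

end Summit.ValiantsHypothesis.ValiantsHypothesis.Theorems.KPlusLogSqLaw.TowerGraft
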